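import Summits.AnomalousDissipation.AnomalousDissipation.Theses.WindLine
import Summits.AnomalousDissipation.AnomalousDissipation.Theses.MirrorVariety
import Literature.Analysis.FluidPDE.LinearizedNSTorus
import Literature.Analysis.FluidPDE.SteadyNSLatticePersistenceDrift
import Summits.AnomalousDissipation.AnomalousDissipation.Theorems.WindLineWindyGalerkinSteadyZerothLawGalerkinNewtonKantorovich
import Summits.AnomalousDissipation.AnomalousDissipation.Theorems.WindLineWindyGalerkinSteadyZerothLawTruncationOnW
import Summits.AnomalousDissipation.AnomalousDissipation.Theorems.WindLineWindyGalerkinSteadyZerothLawLinearisationInjective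
import Summits.AnomalousDissipation.AnomalousDissipation.Theorems.WindLineWindyGalerkinSteadyZerothLawTestedOfLatticeEq
import Summits.AnomalousDissipation.AnomalousDissipation.Theorems.WindLineWindyGalerkinSteadyZerothLawNormsOfH1Limit
import Summits.AnomalousDissipation.AnomalousDissipation.Theorems.WindLineWindyGalerkinSteadyZerothLawGalerkinShadowingGlue

/-!
# Galerkin shadowing of nonsingular steady states, and the continuum transfer of
# `WindLine.WindyGalerkinSteadyZerothLaw` (crux stmt-AnomalousDissipation-11414, line `registered`)

Two theorems assembled from the six landed stubs of the line (files
`WindLineWindyGalerkinSteadyZerothLaw{GalerkinNewtonKantorovich, TruncationOnW, LinearisationInjective,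
TestedOfLatticeEq, NormsOfH1Limit, GalerkinShadowingGlue}.lean`):

* `stub_galerkinShadowing` — the birth skeleton's stub 2, registered on the crux in this expanded form (UNCONDITIONAL; Brezzi–Rappaz–Raviart 1980 Thm. 3 /
  Girault–Raviart 1986 Ch. IV Thm. 3.3 for the spectral Galerkin method on `T³`, run in the conserved-momentum
  leaf): at fixed `ν > 0`, for a smooth divergence-free mean-zero force `f`, every classical steady state `(u, p)`
  of `NS_ν(f)` whose leaf linearisation has trivial kernel (`¬ IsLinNSEigenvalue ν u 0`) is the `H¹`-limit of
  WINDY Fourier–Galerkin steady states (the bracket of X verbatim: smooth, divergence free, band-limited to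
  `freqBall N`, tested Galerkin equations against smooth divergence-free tests band-limited to the punctured
  ball), eventually in the resolution `N`, with `∫|U_N|² → ∫|u|²` and `‖∇U_N‖² → ‖∇u‖²`.
* `windyGalerkinSteadyZerothLaw_of_galerkinSteadyZerothLaw` (pure logic): the CALM sibling crux
  `MirrorVariety.GalerkinSteadyZerothLaw` (stmt-AnomalousDissipation-2986; band-limited to the punctured ball, mean
  zero) implies X (calm ⊂ windy) — the route's kill/supersession criterion as a theorem.
* `windyGalerkinSteadyZerothLaw_of_loudNondegenerateSteadyStates` (CONDITIONAL on the line's heart, stated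
  inline as the hypothesis — it is conjecture-grade, the 3-D steady zeroth law with leaf-nondegeneracy, and is
  NOT a Literature fact): loud bounded leaf-nondegenerate classical steady states along `ν_j → 0⁺` give the
  route's thesis X `WindLine.WindyGalerkinSteadyZerothLaw` BY NAME (strict room passes to the limit along the
  shadowing sequence).

References: F. Brezzi, J. Rappaz, P.-A. Raviart, Numer. Math. 36 (1980) 1–25, Thm. 3; V. Girault,
P.-A. Raviart, *Finite Element Methods for Navier–Stokes Equations* (1986) Ch. IV §3–4; R. Temam,
*Navier–Stokes Equations* (1979) Ch. II §1.
-/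

noncomputable section

-- D-0017: single-problem summit ⇒ the duplicated namespace segment is by design.
set_option linter.dupNamespace false

open scoped InnerProductSpace Topology
open MeasureTheory Filter UnitAddTorus
open Literature.Analysis.FunctionSpaces Literature.Analysis.FunctionSpaces.Torus
open Literature.Analysis.FunctionSpaces.EuclideanSpace
open Literature.Analysis.FluidPDE Literature.Analysis.FluidPDE.Torus

namespace Summit.AnomalousDissipation.AnomalousDissipation.Theorems.WindLineWindyGalerkinSteadyZerothLaw

/-- **Galerkin shadowing of leaf-nondegenerate classical steady states (Brezzi–Rappaz–Raviart for the spectral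
method on `T³`, conserved-momentum leaf).**  At fixed `ν > 0`, for a smooth divergence-free mean-zero force `f`,
every classical steady state `(u, p)` of `NS_ν(f)` with `¬ IsLinNSEigenvalue ν u 0` is shadowed by windy
Fourier–Galerkin steady states: there is `U : ℕ → (T³ → ℝ³)` such that for all large `N`, `U N` is smooth,
divergence free, band-limited to `freqBall N`, and solves the tested Galerkin equations
`∫⟪U,(U·∇)a⟫ + ν⟪U,Δa⟫ + ⟪f,a⟫ = 0` against every smooth divergence-free `a` band-limited to `0 < |k| ≤ N`;
and `∫|U N|² → ∫|u|²`, `‖∇(U N)‖² → ‖∇u‖²`. -/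
theorem stub_galerkinShadowing :
    ∀ (ν : ℝ) (f u : UnitAddTorus (Fin 3) → EuclideanSpace ℝ (Fin 3)) (p : UnitAddTorus (Fin 3) → ℝ),
      0 < ν → IsSmooth f → IsDivFree f → HasZeroMean f →
      IsSteadyNSState ν f u p → ¬ IsLinNSEigenvalue ν u 0 →
        ∃ U : ℕ → UnitAddTorus (Fin 3) → EuclideanSpace ℝ (Fin 3),
          (∀ᶠ N in atTop, IsSmooth (U N) ∧ IsDivFree (U N) ∧
            (∀ k ∉ freqBall N, mFourierCoeff (EuclideanSpace.complexify ∘ U N) k = 0) ∧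
            ∀ a : UnitAddTorus (Fin 3) → EuclideanSpace ℝ (Fin 3), IsSmooth a → IsDivFree a →
              (∀ k ∉ (freqBall N).erase (0 : Fin 3 → ℤ), mFourierCoeff (EuclideanSpace.complexify ∘ a) k = 0) →
              ∫ x, (⟪U N x, convect (U N) a x⟫_ℝ + ν * ⟪U N x, laplacian a x⟫_ℝ + ⟪f x, a x⟫_ℝ) = 0) ∧
          Tendsto (fun N => ∫ x, ‖U N x‖ ^ 2) atTop (𝓝 (∫ x, ‖u x‖ ^ 2)) ∧
          Tendsto (fun N => gradNormSq (U N)) atTop (𝓝 (gradNormSq u)) :=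
  Summit.AnomalousDissipation.AnomalousDissipation.Theorems.WindLineWindyGalerkinSteadyZerothLaw.stub_galerkinShadowingGlue @Summit.AnomalousDissipation.AnomalousDissipation.Theorems.WindLineWindyGalerkinSteadyZerothLaw.stub_galerkinNewtonKantorovich Summit.AnomalousDissipation.AnomalousDissipation.Theorems.WindLineWindyGalerkinSteadyZerothLaw.stub_truncationOnW
    Summit.AnomalousDissipation.AnomalousDissipation.Theorems.WindLineWindyGalerkinSteadyZerothLaw.stub_linearisationInjective Summit.AnomalousDissipation.AnomalousDissipation.Theorems.WindLineWindyGalerkinSteadyZerothLaw.stub_testedOfLatticeEq Summit.AnomalousDissipation.AnomalousDissipation.Theorems.WindLineWindyGalerkinSteadyZerothLaw.stub_normsOfH1Limit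


/-- **Calm ⊂ windy**: the sibling crux `MirrorVariety.GalerkinSteadyZerothLaw` (stmt-AnomalousDissipation-2986: loud
bounded MEAN-ZERO Galerkin steady states, band-limited to the punctured ball `0 < |k| ≤ N`) implies
`WindLine.WindyGalerkinSteadyZerothLaw` (mean mode free, band-limited to the full ball `|k| ≤ N`): a field
band-limited to the punctured ball is band-limited to the ball, and the tested equations are the same. -/
theorem windyGalerkinSteadyZerothLaw_of_galerkinSteadyZerothLaw
    (h : Summit.AnomalousDissipation.AnomalousDissipation.Theses.MirrorVariety.GalerkinSteadyZerothLaw) :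
    Summit.AnomalousDissipation.AnomalousDissipation.Theses.WindLine.WindyGalerkinSteadyZerothLaw := by
  obtain ⟨f, hf, hdf, hmf, ν, E, ε, hν, hν0, hε, hX⟩ := h
  refine ⟨f, hf, hdf, hmf, ν, E, ε, hν, hν0, hε, fun j => (hX j).mono fun N ⟨U, ⟨hU, hUd, _, hband, htest⟩, hE, hεU⟩ =>
    ⟨U, ⟨hU, hUd, fun k hk => hband k fun hk' => hk (Finset.mem_of_mem_erase hk'), htest⟩, hE, hεU⟩⟩

/-- **The continuum transfer of the route's thesis X** (crux stmt-AnomalousDissipation-11414, line `registered`):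
IF some smooth divergence-free mean-zero force on `T³` carries, along some `ν_j → 0⁺` and for some budgets
`E, ε > 0`, classical steady states of `NS_{ν_j}(f)` that are leaf-nondegenerate (`¬ IsLinNSEigenvalue (ν j) u 0`)
with strict room `∫|u|² < E`, `ε < ν_j‖∇u‖²` (the line's HEART — conjecture-grade, stated inline as the
hypothesis; NOT a published fact), THEN `WindLine.WindyGalerkinSteadyZerothLaw` holds: shadow each state by
windy Galerkin steady states (`stub_galerkinShadowing`); strict room and the two convergences give
the non-strict budgets eventually in `N`, hence frequently. -/
theorem windyGalerkinSteadyZerothLaw_of_loudNondegenerateSteadyStates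
    (hHeart : ∃ f : UnitAddTorus (Fin 3) → EuclideanSpace ℝ (Fin 3), IsSmooth f ∧ IsDivFree f ∧ HasZeroMean f ∧
      ∃ (ν : ℕ → ℝ) (E ε : ℝ), (∀ j, 0 < ν j) ∧ Tendsto ν atTop (𝓝 0) ∧ 0 < ε ∧
        ∀ j, ∃ (u : UnitAddTorus (Fin 3) → EuclideanSpace ℝ (Fin 3)) (p : UnitAddTorus (Fin 3) → ℝ),
          IsSteadyNSState (ν j) f u p ∧ ¬ IsLinNSEigenvalue (ν j) u 0 ∧
            ∫ x, ‖u x‖ ^ 2 < E ∧ ε < ν j * gradNormSq u) :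
    Summit.AnomalousDissipation.AnomalousDissipation.Theses.WindLine.WindyGalerkinSteadyZerothLaw := by
  obtain ⟨f, hf, hdf, hmf, ν, E, ε, hν, hν0, hε, hH⟩ := hHeart
  refine ⟨f, hf, hdf, hmf, ν, E, ε, hν, hν0, hε, fun j => ?_⟩
  obtain ⟨u, p, hst, hnd, hE, hεu⟩ := hH j
  obtain ⟨U, hG, hEN, hDN⟩ :=
    stub_galerkinShadowing (ν j) f u p (hν j) hf hdf hmf hst hnd
  -- strict room in the limit ⇒ the non-strict budgets eventually along the shadowing sequence
  have h1 : ∀ᶠ N in atTop, ∫ x, ‖U N x‖ ^ 2 ≤ E :=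
    (hEN.eventually (gt_mem_nhds hE)).mono fun N h => h.le
  have h2 : ∀ᶠ N in atTop, ε ≤ ν j * gradNormSq (U N) :=
    ((hDN.const_mul (ν j)).eventually (lt_mem_nhds hεu)).mono fun N h => h.le
  exact ((hG.and (h1.and h2)).mono fun N h => ⟨U N, h.1, h.2.1, h.2.2⟩).frequently

end Summit.AnomalousDissipation.AnomalousDissipation.Theorems.WindLineWindyGalerkinSteadyZerothLaw

end
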